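import Mathlib
import HarnessLib
import Literature.Geometry.DiscreteGeometry.BondGraph
import Literature.Geometry.DiscreteGeometry.KissingPatterns
import Literature.Algebra.EuclideanLattices.FccBccLattices

/-!
# Small-cluster rigidity I: determinants of bond triples and handedness stability
# (crux `SoftLayerPropagation`, line `Sketch`, stub `stub_metric`, registered sub-goal `metric_handedness`)

Route `PricedLinkCensus`, crux `SoftLayerPropagation` (stmt-AtomisticToContinuum-14233), line `Sketch`.
Helper file of the METRIC half of the line: elementary, radius-independent facts about triples of
vectors of `ℝ³` with explicit constants, in the form consumed by the development of the exact shadow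
crystal (hypothesis `HO`, "handedness stability", of `develop_step` / `develop_reduction`) and by the
octahedron / bipyramid rigidity lemmas of the sibling files.

Throughout, `det u v w` is written `Matrix.det ![WithLp.ofLp u, WithLp.ofLp v, WithLp.ofLp w]` (the signed
volume spanned by `u v w : EuclideanSpace ℝ (Fin 3)`, exactly the term used in `develop_step`).

* `det3_eq` — the coordinate formula (coordinates of `⟪·,·⟫`, `‖·‖²` from `FccBccLattices.lean`); `det3_sq_eq_gram` — `det² = det (Gram matrix)` written out:
  `det² = d₁d₂d₃ + 2 g₁₂ g₁₃ g₂₃ − d₁ g₂₃² − d₂ g₁₃² − d₃ g₁₂²` (`dᵢ = ‖·‖²`, `gᵢⱼ = ⟪·,·⟫`);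
* `det3_sq_le` / `abs_det3_le` — Hadamard: `|det u v w| ≤ ‖u‖ ‖v‖ ‖w‖`;
* `abs_det3_sub_det3_le` — perturbation: `‖uᵢ‖ ≤ M`, `‖wᵢ − uᵢ‖ ≤ η` gives
  `|det w − det u| ≤ η ((M+η)² + M (M+η) + M²)` (telescoping multilinearity + Hadamard);
* `gram_box_lower` — the Gram determinant over the box `dᵢ ∈ [D, D']`, `gᵢⱼ ∈ [g₋, g₊]` is minimised at the
  corner `(D, D, D, g₊, g₊, g₊)` (affine in each `dᵢ`, concave in each `gᵢⱼ`);
* `det3_sq_ge_of_near_unit` — a triple with norms and mutual distances in `[1 − δ, 1 + δ]`, `δ ≤ 1/20`, has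
  `det² ≥ 1/10` (`0.139…` at the corner; the regular value is `1/2`);
* `det3_sq_eq_half_of_contact` — an exact unit contact triple (`‖uᵢ‖ = 1`, `‖uᵢ − uⱼ‖ = 1`) has `det² = 1/2`;
* **`metric_handedness`** (registered sub-goal) — if `u` is an exact unit contact triple and `w` is a triple
  with norms and mutual distances in `[1 − δ, 1 + δ]` (`δ ≤ 1/20`) which is `1/4`-close to `u`
  (`‖wᵢ − uᵢ‖ ≤ 1/4`), then `det u · det w > 0`: `|det w − det u| ≤ 61/64 < 1/√2 + √(1/10) ≤ |det u| + |det w|`.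
  This is the metric input of `HO`: the real contact tetrahedron `(j; k, a, b)` read in the chart at `j`
  (`wᵢ = (y kᵢ − y j)/nn_j`, `uᵢ = A_j pᵢ`) has the handedness of its labels, and the two charts at the ends
  of a bond see the same real tetrahedron up to the sign change `det3_neg_base` below;
* `det3_neg_base`, `det3_smul` — bookkeeping identities: `det (−p) (a − p) (b − p) = − det p a b`
  (re-basing a tetrahedron at the other end of the bond `p`) and `det (c•u) (c•v) (c•w) = c³ det u v w`;

The solving lemma (Cramer) and the octahedron / bipyramid rigidity lemmas are in the sibling files
`…StubMetricSolve`, `…StubMetricOcta`.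

All statements are `[folklore]` (multilinear algebra of `ℝ³`); proofs are coordinate computations closed
by `ring` / `nlinarith` with explicit sum-of-squares certificates.
-/

noncomputable section

namespace Summit.AtomisticToContinuum.Crystallization.Theorems

open Literature.Geometry.DiscreteGeometry

/-! ### Coordinates -/

-- Coordinates of `⟪x, y⟫` and `‖x‖²` in `ℝ³`: `Literature.Algebra.EuclideanLattices.inner_fin_three`,
-- `Literature.Algebra.EuclideanLattices.norm_sq_fin_three` (tree).

/-- The signed volume of three vectors of `ℝ³` in coordinates. [folklore] -/
theorem det3_eq (u v w : EuclideanSpace ℝ (Fin 3)) :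
    Matrix.det ![WithLp.ofLp u, WithLp.ofLp v, WithLp.ofLp w] =
      u 0 * v 1 * w 2 - u 0 * v 2 * w 1 - u 1 * v 0 * w 2 + u 1 * v 2 * w 0 + u 2 * v 0 * w 1 -
        u 2 * v 1 * w 0 := by
  simp [Matrix.det_fin_three]

/-! ### Hadamard's inequality for three vectors -/

/-- Polynomial form of Hadamard's inequality in `ℝ³`: `det² ≤ |a|² |b|² |c|²`, via
`det = a · (b × c)`, Cauchy–Schwarz and Lagrange's identity. [folklore] -/
theorem hadamard_poly_fin3 (a0 a1 a2 b0 b1 b2 c0 c1 c2 : ℝ) :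
    (a0 * b1 * c2 - a0 * b2 * c1 - a1 * b0 * c2 + a1 * b2 * c0 + a2 * b0 * c1 - a2 * b1 * c0) ^ 2 ≤
      (a0 ^ 2 + a1 ^ 2 + a2 ^ 2) * (b0 ^ 2 + b1 ^ 2 + b2 ^ 2) * (c0 ^ 2 + c1 ^ 2 + c2 ^ 2) := by
  set p0 := b1 * c2 - b2 * c1
  set p1 := b2 * c0 - b0 * c2
  set p2 := b0 * c1 - b1 * c0
  have hdet : a0 * b1 * c2 - a0 * b2 * c1 - a1 * b0 * c2 + a1 * b2 * c0 + a2 * b0 * c1 - a2 * b1 * c0 =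
      a0 * p0 + a1 * p1 + a2 * p2 := by simp only [p0, p1, p2]; ring
  have hlag : p0 ^ 2 + p1 ^ 2 + p2 ^ 2 + (b0 * c0 + b1 * c1 + b2 * c2) ^ 2 =
      (b0 ^ 2 + b1 ^ 2 + b2 ^ 2) * (c0 ^ 2 + c1 ^ 2 + c2 ^ 2) := by simp only [p0, p1, p2]; ring
  rw [hdet, mul_assoc, ← hlag]
  nlinarith [sq_nonneg (a0 * p1 - a1 * p0), sq_nonneg (a0 * p2 - a2 * p0), sq_nonneg (a1 * p2 - a2 * p1),
    mul_nonneg (add_nonneg (add_nonneg (sq_nonneg a0) (sq_nonneg a1)) (sq_nonneg a2))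
      (sq_nonneg (b0 * c0 + b1 * c1 + b2 * c2))]

/-- **Hadamard's inequality**, squared form: `det(u,v,w)² ≤ ‖u‖² ‖v‖² ‖w‖²`. [folklore] -/
theorem det3_sq_le (u v w : EuclideanSpace ℝ (Fin 3)) :
    Matrix.det ![WithLp.ofLp u, WithLp.ofLp v, WithLp.ofLp w] ^ 2 ≤ ‖u‖ ^ 2 * ‖v‖ ^ 2 * ‖w‖ ^ 2 := by
  rw [det3_eq, Literature.Algebra.EuclideanLattices.norm_sq_fin_three, Literature.Algebra.EuclideanLattices.norm_sq_fin_three, Literature.Algebra.EuclideanLattices.norm_sq_fin_three]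
  exact hadamard_poly_fin3 _ _ _ _ _ _ _ _ _

/-- **Hadamard's inequality**: `|det(u,v,w)| ≤ ‖u‖ ‖v‖ ‖w‖`. [folklore] -/
theorem abs_det3_le (u v w : EuclideanSpace ℝ (Fin 3)) :
    |Matrix.det ![WithLp.ofLp u, WithLp.ofLp v, WithLp.ofLp w]| ≤ ‖u‖ * ‖v‖ * ‖w‖ := by
  have h := det3_sq_le u v w
  have hn : 0 ≤ ‖u‖ * ‖v‖ * ‖w‖ := by positivity
  rw [← abs_of_nonneg hn]
  exact sq_le_sq.1 (by simpa [mul_pow] using h)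

/-! ### Multilinearity and the perturbation bound -/

/-- Telescoping multilinearity: `det w − det u = det(w₁−u₁, w₂, w₃) + det(u₁, w₂−u₂, w₃) + det(u₁, u₂, w₃−u₃)`.
[folklore] -/
theorem det3_sub_det3_eq (u₁ u₂ u₃ w₁ w₂ w₃ : EuclideanSpace ℝ (Fin 3)) :
    Matrix.det ![WithLp.ofLp w₁, WithLp.ofLp w₂, WithLp.ofLp w₃] -
        Matrix.det ![WithLp.ofLp u₁, WithLp.ofLp u₂, WithLp.ofLp u₃] =
      Matrix.det ![WithLp.ofLp (w₁ - u₁), WithLp.ofLp w₂, WithLp.ofLp w₃] +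
        Matrix.det ![WithLp.ofLp u₁, WithLp.ofLp (w₂ - u₂), WithLp.ofLp w₃] +
        Matrix.det ![WithLp.ofLp u₁, WithLp.ofLp u₂, WithLp.ofLp (w₃ - u₃)] := by
  simp only [det3_eq, PiLp.sub_apply]
  ring

/-- **Perturbation bound for the signed volume.** If `‖uᵢ‖ ≤ M` and `‖wᵢ − uᵢ‖ ≤ η` for the three
vectors, then `|det w − det u| ≤ η ((M + η)² + M (M + η) + M²)`. [folklore] -/
theorem abs_det3_sub_det3_le {M η : ℝ} (hM : 0 ≤ M) (hη : 0 ≤ η)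
    (u₁ u₂ u₃ w₁ w₂ w₃ : EuclideanSpace ℝ (Fin 3))
    (hu₁ : ‖u₁‖ ≤ M) (hu₂ : ‖u₂‖ ≤ M) (hu₃ : ‖u₃‖ ≤ M)
    (he₁ : ‖w₁ - u₁‖ ≤ η) (he₂ : ‖w₂ - u₂‖ ≤ η) (he₃ : ‖w₃ - u₃‖ ≤ η) :
    |Matrix.det ![WithLp.ofLp w₁, WithLp.ofLp w₂, WithLp.ofLp w₃] -
        Matrix.det ![WithLp.ofLp u₁, WithLp.ofLp u₂, WithLp.ofLp u₃]| ≤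
      η * ((M + η) ^ 2 + M * (M + η) + M ^ 2) := by
  have hw₂ : ‖w₂‖ ≤ M + η := by
    have := norm_le_insert' w₂ u₂; linarith
  have hw₃ : ‖w₃‖ ≤ M + η := by
    have := norm_le_insert' w₃ u₃; linarith
  rw [det3_sub_det3_eq]
  have h1 := abs_det3_le (w₁ - u₁) w₂ w₃
  have h2 := abs_det3_le u₁ (w₂ - u₂) w₃
  have h3 := abs_det3_le u₁ u₂ (w₃ - u₃)
  have b1 : ‖w₁ - u₁‖ * ‖w₂‖ * ‖w₃‖ ≤ η * (M + η) * (M + η) := by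
    apply mul_le_mul (mul_le_mul he₁ hw₂ (norm_nonneg _) hη) hw₃ (norm_nonneg _)
    positivity
  have b2 : ‖u₁‖ * ‖w₂ - u₂‖ * ‖w₃‖ ≤ M * η * (M + η) := by
    apply mul_le_mul (mul_le_mul hu₁ he₂ (norm_nonneg _) hM) hw₃ (norm_nonneg _)
    positivity
  have b3 : ‖u₁‖ * ‖u₂‖ * ‖w₃ - u₃‖ ≤ M * M * η := by
    apply mul_le_mul (mul_le_mul hu₁ hu₂ (norm_nonneg _) hM) he₃ (norm_nonneg _)
    positivity
  calc _ ≤ |Matrix.det ![WithLp.ofLp (w₁ - u₁), WithLp.ofLp w₂, WithLp.ofLp w₃]| +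
        |Matrix.det ![WithLp.ofLp u₁, WithLp.ofLp (w₂ - u₂), WithLp.ofLp w₃]| +
        |Matrix.det ![WithLp.ofLp u₁, WithLp.ofLp u₂, WithLp.ofLp (w₃ - u₃)]| := abs_add_three _ _ _
    _ ≤ η * (M + η) * (M + η) + M * η * (M + η) + M * M * η := by linarith
    _ = η * ((M + η) ^ 2 + M * (M + η) + M ^ 2) := by ring

/-! ### The Gram determinant -/

/-- **`det² = det Gram`** for three vectors of `ℝ³`, written out:
`det(u,v,w)² = d₁d₂d₃ + 2 g₁₂ g₁₃ g₂₃ − d₁ g₂₃² − d₂ g₁₃² − d₃ g₁₂²` with `dᵢ = ‖·‖²`, `gᵢⱼ = ⟪·,·⟫`.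
[folklore] -/
theorem det3_sq_eq_gram (u v w : EuclideanSpace ℝ (Fin 3)) :
    Matrix.det ![WithLp.ofLp u, WithLp.ofLp v, WithLp.ofLp w] ^ 2 =
      ‖u‖ ^ 2 * ‖v‖ ^ 2 * ‖w‖ ^ 2 + 2 * inner ℝ u v * inner ℝ u w * inner ℝ v w -
        ‖u‖ ^ 2 * inner ℝ v w ^ 2 - ‖v‖ ^ 2 * inner ℝ u w ^ 2 - ‖w‖ ^ 2 * inner ℝ u v ^ 2 := by
  simp only [det3_eq, Literature.Algebra.EuclideanLattices.norm_sq_fin_three, Literature.Algebra.EuclideanLattices.inner_fin_three]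
  ring

/-- `⟪u, v⟫ = (‖u‖² + ‖v‖² − ‖u − v‖²)/2` (polarisation). [folklore] -/
theorem inner_eq_of_norm_sub (u v : EuclideanSpace ℝ (Fin 3)) :
    inner ℝ u v = (‖u‖ ^ 2 + ‖v‖ ^ 2 - ‖u - v‖ ^ 2) / 2 := by
  have := norm_sub_sq_real u v
  linarith

/-- **The Gram cubic over a box.**  For `D ≤ dᵢ`, `g₋ ≤ gᵢⱼ ≤ g₊` with `0 ≤ g₋`, `g₊² ≤ D²`... precisely
`g₊ ≤ D` and `2 g₊² ≤ D (g₊ + g₋)`, the cubic `d₁d₂d₃ + 2 g₁₂ g₁₃ g₂₃ − d₁ g₂₃² − d₂ g₁₃² − d₃ g₁₂²`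
is at least its value `D³ + 2 g₊³ − 3 D g₊²` at the corner `(D,D,D,g₊,g₊,g₊)`: it is affine and
increasing in each `dᵢ` and concave in each `gᵢⱼ` with the smaller endpoint value at `g₊`. [folklore] -/
theorem gram_box_lower {D gm gp d₁ d₂ d₃ g₁₂ g₁₃ g₂₃ : ℝ} (hD : 0 ≤ D) (hgm : 0 ≤ gm)
    (hgpD : gp ≤ D) (hcmp : 2 * gp ^ 2 ≤ D * (gp + gm))
    (hd₁ : D ≤ d₁) (hd₂ : D ≤ d₂) (hd₃ : D ≤ d₃)
    (h₁₂ : gm ≤ g₁₂) (h₁₂' : g₁₂ ≤ gp) (h₁₃ : gm ≤ g₁₃) (h₁₃' : g₁₃ ≤ gp)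
    (h₂₃ : gm ≤ g₂₃) (h₂₃' : g₂₃ ≤ gp) :
    D ^ 3 + 2 * gp ^ 3 - 3 * D * gp ^ 2 ≤
      d₁ * d₂ * d₃ + 2 * g₁₂ * g₁₃ * g₂₃ - d₁ * g₂₃ ^ 2 - d₂ * g₁₃ ^ 2 - d₃ * g₁₂ ^ 2 := by
  have hgp : 0 ≤ gp := hgm.trans (h₁₂.trans h₁₂')
  have g12nn : 0 ≤ g₁₂ := hgm.trans h₁₂
  have g13nn : 0 ≤ g₁₃ := hgm.trans h₁₃
  have g23nn : 0 ≤ g₂₃ := hgm.trans h₂₃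
  -- squares of the `g`'s are at most `D²`
  have s12 : g₁₂ ^ 2 ≤ D ^ 2 := pow_le_pow_left₀ g12nn (h₁₂'.trans hgpD) 2
  have s13 : g₁₃ ^ 2 ≤ D ^ 2 := pow_le_pow_left₀ g13nn (h₁₃'.trans hgpD) 2
  have s23 : g₂₃ ^ 2 ≤ D ^ 2 := pow_le_pow_left₀ g23nn (h₂₃'.trans hgpD) 2
  -- Step A: lower the `dᵢ` to `D`
  have A1 : D * d₂ * d₃ + 2 * g₁₂ * g₁₃ * g₂₃ - D * g₂₃ ^ 2 - d₂ * g₁₃ ^ 2 - d₃ * g₁₂ ^ 2 ≤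
      d₁ * d₂ * d₃ + 2 * g₁₂ * g₁₃ * g₂₃ - d₁ * g₂₃ ^ 2 - d₂ * g₁₃ ^ 2 - d₃ * g₁₂ ^ 2 := by
    have : 0 ≤ (d₁ - D) * (d₂ * d₃ - g₂₃ ^ 2) := by
      apply mul_nonneg (by linarith)
      nlinarith [mul_le_mul hd₂ hd₃ hD (hD.trans hd₂)]
    nlinarith
  have A2 : D * D * d₃ + 2 * g₁₂ * g₁₃ * g₂₃ - D * g₂₃ ^ 2 - D * g₁₃ ^ 2 - d₃ * g₁₂ ^ 2 ≤
      D * d₂ * d₃ + 2 * g₁₂ * g₁₃ * g₂₃ - D * g₂₃ ^ 2 - d₂ * g₁₃ ^ 2 - d₃ * g₁₂ ^ 2 := by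
    have : 0 ≤ (d₂ - D) * (D * d₃ - g₁₃ ^ 2) := by
      apply mul_nonneg (by linarith)
      nlinarith [mul_le_mul_of_nonneg_left hd₃ hD]
    nlinarith
  have A3 : D * D * D + 2 * g₁₂ * g₁₃ * g₂₃ - D * g₂₃ ^ 2 - D * g₁₃ ^ 2 - D * g₁₂ ^ 2 ≤
      D * D * d₃ + 2 * g₁₂ * g₁₃ * g₂₃ - D * g₂₃ ^ 2 - D * g₁₃ ^ 2 - d₃ * g₁₂ ^ 2 := by
    have : 0 ≤ (d₃ - D) * (D * D - g₁₂ ^ 2) := by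
      apply mul_nonneg (by linarith)
      nlinarith
    nlinarith
  -- Step B: raise the `gᵢⱼ` to `gp` (concavity; the endpoint `gp` is the smaller one)
  have B1 : D * D * D + 2 * gp * g₁₃ * g₂₃ - D * g₂₃ ^ 2 - D * g₁₃ ^ 2 - D * gp ^ 2 ≤
      D * D * D + 2 * g₁₂ * g₁₃ * g₂₃ - D * g₂₃ ^ 2 - D * g₁₃ ^ 2 - D * g₁₂ ^ 2 := by
    have hprod : g₁₃ * g₂₃ ≤ gp * gp := mul_le_mul h₁₃' h₂₃' g23nn hgp
    have : 0 ≤ (gp - g₁₂) * (D * (g₁₂ + gp) - 2 * (g₁₃ * g₂₃)) := by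
      apply mul_nonneg (by linarith)
      nlinarith [mul_le_mul_of_nonneg_left (add_le_add_right h₁₂ gp) hD]
    nlinarith
  have B2 : D * D * D + 2 * gp * gp * g₂₃ - D * g₂₃ ^ 2 - D * gp ^ 2 - D * gp ^ 2 ≤
      D * D * D + 2 * gp * g₁₃ * g₂₃ - D * g₂₃ ^ 2 - D * g₁₃ ^ 2 - D * gp ^ 2 := by
    have hprod : gp * g₂₃ ≤ gp * gp := mul_le_mul_of_nonneg_left h₂₃' hgp
    have : 0 ≤ (gp - g₁₃) * (D * (g₁₃ + gp) - 2 * (gp * g₂₃)) := by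
      apply mul_nonneg (by linarith)
      nlinarith [mul_le_mul_of_nonneg_left (add_le_add_right h₁₃ gp) hD]
    nlinarith
  have B3 : D * D * D + 2 * gp * gp * gp - D * gp ^ 2 - D * gp ^ 2 - D * gp ^ 2 ≤
      D * D * D + 2 * gp * gp * g₂₃ - D * g₂₃ ^ 2 - D * gp ^ 2 - D * gp ^ 2 := by
    have : 0 ≤ (gp - g₂₃) * (D * (g₂₃ + gp) - 2 * (gp * gp)) := by
      apply mul_nonneg (by linarith)
      nlinarith [mul_le_mul_of_nonneg_left (add_le_add_right h₂₃ gp) hD]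
    nlinarith
  nlinarith

/-- The corner value of the Gram cubic for the window `[1 − δ, 1 + δ]`, `δ ≤ 1/20`, is at least `1/10`
(a univariate polynomial inequality: `2/5 − 9δ + 63δ²/2 + 82δ³ + 63δ⁴/2 − 9δ⁵ + δ⁶/2 ≥ 0`). [folklore] -/
theorem gram_corner_ge {δ : ℝ} (hδ : 0 ≤ δ) (hδ' : δ ≤ 1 / 20) :
    (1 : ℝ) / 10 ≤ ((1 - δ) ^ 2) ^ 3 + 2 * ((2 * (1 + δ) ^ 2 - (1 - δ) ^ 2) / 2) ^ 3 -
      3 * (1 - δ) ^ 2 * ((2 * (1 + δ) ^ 2 - (1 - δ) ^ 2) / 2) ^ 2 := by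
  have expand : ((1 - δ) ^ 2) ^ 3 + 2 * ((2 * (1 + δ) ^ 2 - (1 - δ) ^ 2) / 2) ^ 3 -
      3 * (1 - δ) ^ 2 * ((2 * (1 + δ) ^ 2 - (1 - δ) ^ 2) / 2) ^ 2 =
      1 / 2 - 9 * δ + 63 / 2 * δ ^ 2 + 82 * δ ^ 3 + 63 / 2 * δ ^ 4 - 9 * δ ^ 5 + 1 / 2 * δ ^ 6 := by ring
  rw [expand]
  have h3 : 0 ≤ δ ^ 3 := pow_nonneg hδ 3
  have h4 : 0 ≤ δ ^ 4 := pow_nonneg hδ 4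
  have h6 : 0 ≤ δ ^ 6 := pow_nonneg hδ 6
  have h5 : δ ^ 5 ≤ δ ^ 2 / 8000 := by
    have : δ ^ 3 ≤ (1 / 20) ^ 3 := pow_le_pow_left₀ hδ hδ' 3
    calc δ ^ 5 = δ ^ 2 * δ ^ 3 := by ring
      _ ≤ δ ^ 2 * (1 / 20) ^ 3 := mul_le_mul_of_nonneg_left this (sq_nonneg δ)
      _ = δ ^ 2 / 8000 := by ring
  nlinarith [mul_nonneg (sub_nonneg.2 hδ') (sub_nonneg.2 hδ'), mul_nonneg hδ (sub_nonneg.2 hδ')]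

/-- **Lower bound for the Gram cubic of a near-unit triple**, real-variable form: norms `aᵢ` and mutual
distances `bᵢⱼ` in `[1 − δ, 1 + δ]`, `0 ≤ δ ≤ 1/20`, give Gram cubic `≥ 1/10`. [folklore] -/
theorem gram_near_unit_lower {δ a₁ a₂ a₃ b₁₂ b₁₃ b₂₃ : ℝ} (hδ : 0 ≤ δ) (hδ' : δ ≤ 1 / 20)
    (n₁ : 1 - δ ≤ a₁) (n₁' : a₁ ≤ 1 + δ) (n₂ : 1 - δ ≤ a₂) (n₂' : a₂ ≤ 1 + δ)
    (n₃ : 1 - δ ≤ a₃) (n₃' : a₃ ≤ 1 + δ)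
    (d₁₂ : 1 - δ ≤ b₁₂) (d₁₂' : b₁₂ ≤ 1 + δ) (d₁₃ : 1 - δ ≤ b₁₃) (d₁₃' : b₁₃ ≤ 1 + δ)
    (d₂₃ : 1 - δ ≤ b₂₃) (d₂₃' : b₂₃ ≤ 1 + δ) :
    (1 : ℝ) / 10 ≤ a₁ ^ 2 * a₂ ^ 2 * a₃ ^ 2 +
      2 * ((a₁ ^ 2 + a₂ ^ 2 - b₁₂ ^ 2) / 2) * ((a₁ ^ 2 + a₃ ^ 2 - b₁₃ ^ 2) / 2) *
        ((a₂ ^ 2 + a₃ ^ 2 - b₂₃ ^ 2) / 2) -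
      a₁ ^ 2 * ((a₂ ^ 2 + a₃ ^ 2 - b₂₃ ^ 2) / 2) ^ 2 - a₂ ^ 2 * ((a₁ ^ 2 + a₃ ^ 2 - b₁₃ ^ 2) / 2) ^ 2 -
      a₃ ^ 2 * ((a₁ ^ 2 + a₂ ^ 2 - b₁₂ ^ 2) / 2) ^ 2 := by
  have h1δ : 0 ≤ 1 - δ := by linarith
  have sqlo : ∀ x : ℝ, 1 - δ ≤ x → (1 - δ) ^ 2 ≤ x ^ 2 := fun x hx => pow_le_pow_left₀ h1δ hx 2
  have sqhi : ∀ x : ℝ, 1 - δ ≤ x → x ≤ 1 + δ → x ^ 2 ≤ (1 + δ) ^ 2 := fun x hx hx' =>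
    pow_le_pow_left₀ (h1δ.trans hx) hx' 2
  have e₁ := sqlo _ n₁; have e₁' := sqhi _ n₁ n₁'
  have e₂ := sqlo _ n₂; have e₂' := sqhi _ n₂ n₂'
  have e₃ := sqlo _ n₃; have e₃' := sqhi _ n₃ n₃'
  have f₁₂ := sqlo _ d₁₂; have f₁₂' := sqhi _ d₁₂ d₁₂'
  have f₁₃ := sqlo _ d₁₃; have f₁₃' := sqhi _ d₁₃ d₁₃'
  have f₂₃ := sqlo _ d₂₃; have f₂₃' := sqhi _ d₂₃ d₂₃'
  -- the box: `D = (1-δ)²`, `gp = (2(1+δ)² − (1−δ)²)/2`, `gm = (2(1−δ)² − (1+δ)²)/2`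
  have hD : (0 : ℝ) ≤ (1 - δ) ^ 2 := by positivity
  have hgm : (0 : ℝ) ≤ (2 * (1 - δ) ^ 2 - (1 + δ) ^ 2) / 2 := by nlinarith
  have hgpD : (2 * (1 + δ) ^ 2 - (1 - δ) ^ 2) / 2 ≤ (1 - δ) ^ 2 := by nlinarith
  have hcmp : 2 * ((2 * (1 + δ) ^ 2 - (1 - δ) ^ 2) / 2) ^ 2 ≤
      (1 - δ) ^ 2 * ((2 * (1 + δ) ^ 2 - (1 - δ) ^ 2) / 2 + (2 * (1 - δ) ^ 2 - (1 + δ) ^ 2) / 2) := by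
    nlinarith [mul_nonneg hδ hδ, mul_nonneg (mul_nonneg hδ hδ) hδ, mul_nonneg (mul_nonneg hδ hδ) (mul_nonneg hδ hδ)]
  have g₁₂lo : (2 * (1 - δ) ^ 2 - (1 + δ) ^ 2) / 2 ≤ (a₁ ^ 2 + a₂ ^ 2 - b₁₂ ^ 2) / 2 := by linarith
  have g₁₂hi : (a₁ ^ 2 + a₂ ^ 2 - b₁₂ ^ 2) / 2 ≤ (2 * (1 + δ) ^ 2 - (1 - δ) ^ 2) / 2 := by linarith
  have g₁₃lo : (2 * (1 - δ) ^ 2 - (1 + δ) ^ 2) / 2 ≤ (a₁ ^ 2 + a₃ ^ 2 - b₁₃ ^ 2) / 2 := by linarith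
  have g₁₃hi : (a₁ ^ 2 + a₃ ^ 2 - b₁₃ ^ 2) / 2 ≤ (2 * (1 + δ) ^ 2 - (1 - δ) ^ 2) / 2 := by linarith
  have g₂₃lo : (2 * (1 - δ) ^ 2 - (1 + δ) ^ 2) / 2 ≤ (a₂ ^ 2 + a₃ ^ 2 - b₂₃ ^ 2) / 2 := by linarith
  have g₂₃hi : (a₂ ^ 2 + a₃ ^ 2 - b₂₃ ^ 2) / 2 ≤ (2 * (1 + δ) ^ 2 - (1 - δ) ^ 2) / 2 := by linarith
  have key := gram_box_lower hD hgm hgpD hcmp e₁ e₂ e₃ g₁₂lo g₁₂hi g₁₃lo g₁₃hi g₂₃lo g₂₃hi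
  have corner := gram_corner_ge hδ hδ'
  linarith

/-- **Lower bound for the volume of a near-unit triple.**  If the three vectors have norms and mutual
distances in `[1 − δ, 1 + δ]` with `0 ≤ δ ≤ 1/20`, then `det² ≥ 1/10` (the regular value is `1/2`; the
Gram corner value at `δ = 1/20` is `0.139…`). [folklore] -/
theorem det3_sq_ge_of_near_unit {δ : ℝ} (hδ : 0 ≤ δ) (hδ' : δ ≤ 1 / 20)
    (w₁ w₂ w₃ : EuclideanSpace ℝ (Fin 3))
    (n₁ : 1 - δ ≤ ‖w₁‖) (n₁' : ‖w₁‖ ≤ 1 + δ) (n₂ : 1 - δ ≤ ‖w₂‖) (n₂' : ‖w₂‖ ≤ 1 + δ)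
    (n₃ : 1 - δ ≤ ‖w₃‖) (n₃' : ‖w₃‖ ≤ 1 + δ)
    (d₁₂ : 1 - δ ≤ ‖w₁ - w₂‖) (d₁₂' : ‖w₁ - w₂‖ ≤ 1 + δ)
    (d₁₃ : 1 - δ ≤ ‖w₁ - w₃‖) (d₁₃' : ‖w₁ - w₃‖ ≤ 1 + δ)
    (d₂₃ : 1 - δ ≤ ‖w₂ - w₃‖) (d₂₃' : ‖w₂ - w₃‖ ≤ 1 + δ) :
    1 / 10 ≤ Matrix.det ![WithLp.ofLp w₁, WithLp.ofLp w₂, WithLp.ofLp w₃] ^ 2 := by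
  rw [det3_sq_eq_gram, inner_eq_of_norm_sub w₁ w₂, inner_eq_of_norm_sub w₁ w₃, inner_eq_of_norm_sub w₂ w₃]
  exact gram_near_unit_lower hδ hδ' n₁ n₁' n₂ n₂' n₃ n₃' d₁₂ d₁₂' d₁₃ d₁₃' d₂₃ d₂₃'

/-- An **exact unit contact triple** (`‖uᵢ‖ = 1`, `‖uᵢ − uⱼ‖ = 1`: three pattern points pairwise in
contact, e.g. the labels of a contact tetrahedron in an FCC/HCP chart) spans volume `det² = 1/2`.
[folklore] -/
theorem det3_sq_eq_half_of_contact (u₁ u₂ u₃ : EuclideanSpace ℝ (Fin 3))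
    (h₁ : ‖u₁‖ = 1) (h₂ : ‖u₂‖ = 1) (h₃ : ‖u₃‖ = 1)
    (h₁₂ : ‖u₁ - u₂‖ = 1) (h₁₃ : ‖u₁ - u₃‖ = 1) (h₂₃ : ‖u₂ - u₃‖ = 1) :
    Matrix.det ![WithLp.ofLp u₁, WithLp.ofLp u₂, WithLp.ofLp u₃] ^ 2 = 1 / 2 := by
  rw [det3_sq_eq_gram, inner_eq_of_norm_sub u₁ u₂, inner_eq_of_norm_sub u₁ u₃, inner_eq_of_norm_sub u₂ u₃,
    h₁, h₂, h₃, h₁₂, h₁₃, h₂₃]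
  norm_num

/-! ### Handedness stability (registered sub-goal `metric_handedness`) -/

/-- **Handedness stability** (metric input of hypothesis `HO` of the shadow development).  Let
`u₁ u₂ u₃` be an exact unit contact triple (`‖uᵢ‖ = 1`, `‖uᵢ − uⱼ‖ = 1`) and `w₁ w₂ w₃` a triple with
norms and mutual distances in `[1 − δ, 1 + δ]`, `0 ≤ δ ≤ 1/20`, which is `1/4`-close to it
(`‖wᵢ − uᵢ‖ ≤ 1/4`).  Then the two signed volumes have the same sign: `det u · det w > 0`.
(`|det w − det u| ≤ 61/64` by the perturbation bound, while `det u² = 1/2` and `det w² ≥ 1/10`, and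
`61/64 < √(1/2) + √(1/10)`.)  In the bond setting: `wᵢ = (y kᵢ − y j)/nn_j` for a contact tetrahedron
`(j; k₁, k₂, k₃)` at `η ≤ 1/100` (norms in `[1, 1.01]`, mutual distances in `[1/1.01, 1.0201]`) and
`uᵢ = A pᵢ` its chart labels. [folklore] -/
theorem metric_handedness : ∀ δ : ℝ, 0 ≤ δ → δ ≤ 1 / 20 →
    ∀ (u₁ u₂ u₃ w₁ w₂ w₃ : EuclideanSpace ℝ (Fin 3)),
      ‖u₁‖ = 1 → ‖u₂‖ = 1 → ‖u₃‖ = 1 → ‖u₁ - u₂‖ = 1 → ‖u₁ - u₃‖ = 1 → ‖u₂ - u₃‖ = 1 →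
      1 - δ ≤ ‖w₁‖ → ‖w₁‖ ≤ 1 + δ → 1 - δ ≤ ‖w₂‖ → ‖w₂‖ ≤ 1 + δ → 1 - δ ≤ ‖w₃‖ → ‖w₃‖ ≤ 1 + δ →
      1 - δ ≤ ‖w₁ - w₂‖ → ‖w₁ - w₂‖ ≤ 1 + δ → 1 - δ ≤ ‖w₁ - w₃‖ → ‖w₁ - w₃‖ ≤ 1 + δ →
      1 - δ ≤ ‖w₂ - w₃‖ → ‖w₂ - w₃‖ ≤ 1 + δ →
      ‖w₁ - u₁‖ ≤ 1 / 4 → ‖w₂ - u₂‖ ≤ 1 / 4 → ‖w₃ - u₃‖ ≤ 1 / 4 →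
      0 < Matrix.det ![WithLp.ofLp u₁, WithLp.ofLp u₂, WithLp.ofLp u₃] *
        Matrix.det ![WithLp.ofLp w₁, WithLp.ofLp w₂, WithLp.ofLp w₃] := by
  intro δ hδ hδ' u₁ u₂ u₃ w₁ w₂ w₃ hu₁ hu₂ hu₃ hu₁₂ hu₁₃ hu₂₃ n₁ n₁' n₂ n₂' n₃ n₃' d₁₂ d₁₂' d₁₃ d₁₃' d₂₃ d₂₃'
    c₁ c₂ c₃
  set A := Matrix.det ![WithLp.ofLp u₁, WithLp.ofLp u₂, WithLp.ofLp u₃] with hA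
  set B := Matrix.det ![WithLp.ofLp w₁, WithLp.ofLp w₂, WithLp.ofLp w₃] with hB
  have hA2 : A ^ 2 = 1 / 2 := det3_sq_eq_half_of_contact u₁ u₂ u₃ hu₁ hu₂ hu₃ hu₁₂ hu₁₃ hu₂₃
  have hB2 : 1 / 10 ≤ B ^ 2 :=
    det3_sq_ge_of_near_unit hδ hδ' w₁ w₂ w₃ n₁ n₁' n₂ n₂' n₃ n₃' d₁₂ d₁₂' d₁₃ d₁₃' d₂₃ d₂₃'
  have hdiff : |B - A| ≤ 61 / 64 := by
    have h := abs_det3_sub_det3_le (M := 1) (η := 1 / 4) (by norm_num) (by norm_num) u₁ u₂ u₃ w₁ w₂ w₃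
      hu₁.le hu₂.le hu₃.le c₁ c₂ c₃
    have : (1 / 4 : ℝ) * ((1 + 1 / 4) ^ 2 + 1 * (1 + 1 / 4) + 1 ^ 2) = 61 / 64 := by norm_num
    rw [this] at h
    exact h
  -- if the signs differed, `|B − A| = |A| + |B| ≥ √(1/2) + √(1/10) > 61/64`
  by_contra hneg
  have hAB : A * B ≤ 0 := not_lt.1 hneg
  have habs := abs_le.1 hdiff
  have hsq : (B - A) ^ 2 ≤ (61 / 64) ^ 2 := sq_le_sq' (by linarith [habs.1]) habs.2
  have hprod : 1 / 20 ≤ (A * B) ^ 2 := by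
    rw [mul_pow, hA2]; linarith
  -- `AB ≤ 0` and `(AB)² ≥ 1/20 > (2/9)²` give `AB ≤ −2/9`
  have hAB' : A * B ≤ -(2 / 9) := by nlinarith
  -- `(B − A)² = A² + B² − 2AB ≥ 1/2 + 1/10 + 4/9 > (61/64)²`
  nlinarith

/-! ### Bookkeeping identities -/

/-- **Re-basing a contact tetrahedron at the other end of a bond.**  With `p = y k − y j`,
`a = y a − y j`, `b = y b − y j`, the triple read from `k` is `(−p, a − p, b − p)` and
`det (−p) (a − p) (b − p) = − det p a b`. [folklore] -/
theorem det3_neg_base (p a b : EuclideanSpace ℝ (Fin 3)) :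
    Matrix.det ![WithLp.ofLp (-p), WithLp.ofLp (a - p), WithLp.ofLp (b - p)] =
      - Matrix.det ![WithLp.ofLp p, WithLp.ofLp a, WithLp.ofLp b] := by
  simp only [det3_eq, PiLp.sub_apply, PiLp.neg_apply]
  ring

/-- Scaling all three vectors by `c` scales the signed volume by `c³`. [folklore] -/
theorem det3_smul (c : ℝ) (u v w : EuclideanSpace ℝ (Fin 3)) :
    Matrix.det ![WithLp.ofLp (c • u), WithLp.ofLp (c • v), WithLp.ofLp (c • w)] =
      c ^ 3 * Matrix.det ![WithLp.ofLp u, WithLp.ofLp v, WithLp.ofLp w] := by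
  simp only [det3_eq, PiLp.smul_apply, smul_eq_mul]
  ring

/-- Translating the three far vertices and the base vertex together does not change the signed
volume: `det (a − p) (b − p) (c − p)` is the volume form of the tetrahedron `(p; a, b, c)`; in
particular it is symmetric information shared by every chart that sees the four sites. (Stated as the
expansion used downstream.) [folklore] -/
theorem det3_sub_base_swap (p a b c : EuclideanSpace ℝ (Fin 3)) :
    Matrix.det ![WithLp.ofLp (p - a), WithLp.ofLp (b - a), WithLp.ofLp (c - a)] =
      - Matrix.det ![WithLp.ofLp (a - p), WithLp.ofLp (b - p), WithLp.ofLp (c - p)] := by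
  simp only [det3_eq, PiLp.sub_apply]
  ring

end Summit.AtomisticToContinuum.Crystallization.Theorems

end
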